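import Summits.NavierStokesRegularity.FluidComputer.PalasekTowerBurgersNumberStrain
import Summits.NavierStokesRegularity.FluidComputer.PalasekTowerFaceLacunarityLaws

/-!
# The Burgers child core at a RE-TUNED register: the level-1 letter met with natural endowment `(C, λ) = (3/2, 1)`
# once the Burgers factor `B := N₀^{β/2−b} = √Re₀/σ` exceeds `40/3`, and missed everywhere on the wide rates
# (crux `EpisodeBase`, stmt-NavierStokesRegularity-19179; kernel companion II of the holder's RE-TUNING BRIEF v1.2c §9)

Cell `ns-blowup`, seat `ns-palasek-19179-p2` (g5; holder of record of `EpisodeBase` = `EpisodeBaseG`). Instantiation of ecbridge-8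
g3's certified Burgers bands (`PalasekTowerBurgersNumber.lean` p433323 / `PalasekTowerBurgersNumberStrain.lean`: MODEL identification
«level-`1` child core = Burgers vortex of circulation `C·N₁^{β−2}` in the strain `λ·A₀`, `ν = 1`»; peak swirl
`∈ [0.632, 0.708]·C√λ·B·Y₁/(4π)`, strain on the axis `(Cλ/8π)·B²·A₁`) at the variables of the brief
(`PalasekTowerFaceLacunarityLaws.lean` p511376): `B = N₀^{β/2−b}` is `√Re₀/σ` (§1), and

* §2 (ANY rates): if `B ≥ 40/3` the child core with the NATURAL endowment `C = 3/2` (circulation `3/2` × its floor) at the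
  level-`0` strain floor `λ = 1` MEETS the speed floor `Y₁` somewhere; if `B ≤ 177/10` it stays below the soft ceiling `(3/2)·Y₁`
  (a fortiori below `(5/3)·Y₁`) everywhere; if `B² ≥ 17` it MEETS the strain floor `A₁` on its axis;
* §3 (the corner): any rates record with `(N₀, b, β) = (2^23, 41/40, 12/5)` (the brief's `deepA′`: `Re₀ = 2^{46/5} ≈ 588`,
  `σ = 2^{23/40} ≈ 1.49`) has `B = 2^{161/40} ∈ (16.27, 16.29)`, hence all three at `(C, λ) = (3/2, 1)`;
* §4 (the item of record): on `TowerRates.wide` `B = 2^{2/5} < 1.32`, and EVERY Burgers child core with `C√λ ≤ 13` misses the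
  speed floor `Y₁` at EVERY point (`13·1.32 < 4√2π`) — the MECHTOY-OSC-1 kill of the crux idea `orthogonal-seed-contact-strain` at the
  registered tuning, in one line.

LABEL: E–C / MODEL register arithmetic (KERNEL: exact rate algebra + certified numerics over landed Literature theorems on the Burgers
vortex). WHAT THIS IS NOT: not Navier–Stokes evidence — the Burgers vortex is an exact steady INFINITE-energy profile and no registered
stage; nothing is asserted about any registered flow, about `EpisodeBase`, or about the re-tuned item (which does not exist: D-0014,
planner). No re-tuning is proposed here.

References: P. G. Saffman, *Vortex Dynamics* (CUP 1992) §13.1 (3)–(4) [cite: Saffman1992, §13.1 eq. (4)]; S. Palasek,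
arXiv:2605.13827 §3 (3.2) [cite: Palasek2026ElementaryModel, §3 (3.2)]; RE-TUNING BRIEF v1.2c (19179 evidence #56).
-/

noncomputable section

namespace Summit.NavierStokesRegularity.FluidComputer.PalasekTowerClayBridge

open Real
open Literature.Analysis.FluidPDE

/-! ## §1 The Burgers factor in the brief's variables -/

namespace TowerRates

variable (R : TowerRates)

/-- **The Burgers factor is `√Re₀/σ`**: `N₀^{β/2−b} = (N₀^{β−2})^{1/2} / N₀^{b−1}`. [cite: Palasek2026ElementaryModel, §3 (3.2)] -/
theorem burgersFactor_eq_sqrt_Re₀_div_sigma :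
    R.N 0 ^ (R.β / 2 - R.b) = Real.sqrt (R.N₀ ^ (R.β - 2)) / R.N₀ ^ (R.b - 1) := by
  rw [R.N_zero_eq_N₀, Real.sqrt_eq_rpow, ← Real.rpow_mul R.N₀_pos.le, ← Real.rpow_sub R.N₀_pos]
  congr 1
  ring

/-- **The squared Burgers factor is the DC1 margin `N₀^{β−2b}`** (= `κ · 4b²β log N₀` of p511376). [folklore] -/
theorem burgersFactor_sq : (R.N 0 ^ (R.β / 2 - R.b)) ^ 2 = R.N 0 ^ (R.β - 2 * R.b) := by
  rw [← Real.rpow_natCast, ← Real.rpow_mul (R.N_pos 0).le]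
  congr 1
  push_cast
  ring

end TowerRates

/-! ## §2 Natural endowment `(C, λ) = (3/2, 1)` against the three faces, for ANY rates with a large Burgers factor -/

/-- `500π/79 ≤ 20` (`= 19.88…`; with `C = 3/2` the floor threshold `C·B ≥ 500π/79` holds once `B ≥ 40/3`). [folklore] -/
theorem five_hundred_pi_div_79_le_twenty : 500 * π / 79 ≤ (20 : ℝ) := by
  have := Real.pi_lt_d2
  rw [div_le_iff₀ (by norm_num : (0 : ℝ) < 79)]
  nlinarith

/-- `4√2π > 177/10`. [folklore] -/
theorem four_sqrt_two_pi_gt : (177 : ℝ) / 10 < 4 * Real.sqrt 2 * π := by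
  have hpi := Real.pi_gt_d4
  have hs : (1.4142 : ℝ) < Real.sqrt 2 := by
    rw [Real.lt_sqrt (by norm_num)]; norm_num
  nlinarith

/-- **SPEED FLOOR at natural endowment**: for any rates with Burgers factor `B = N₀^{β/2−b} ≥ 40/3`, the Burgers child core of
circulation `(3/2)·N₁^{β−2}` in the level-`0` strain floor `1·A₀` (`ν = 1`) has swirl speed `≥ Y₁` at some point.
[cite: Saffman1992, §13.1 eq. (4)] -/
theorem palasekTowerBreakdown_burgersCorner_floor (R : TowerRates) (hB : (40 : ℝ) / 3 ≤ R.N 0 ^ (R.β / 2 - R.b)) :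
    ∃ x : EuclideanSpace ℝ (Fin 3),
      1 * R.Y (0 + 1) ≤ ‖burgersVortexSwirl (1 * R.A 0) 1 (3 / 2 * R.N (0 + 1) ^ (R.β - 2)) x‖ := by
  refine palasekTowerBreakdown_burgers_floor R 0 (by norm_num) one_pos ?_
  rw [Real.sqrt_one, mul_one, mul_one]
  have h20 := five_hundred_pi_div_79_le_twenty
  nlinarith

/-- **SOFT CEILING at natural endowment**: for any rates with `B ≤ 177/10`, the same child core stays below `(3/2)·Y₁` at every
point (hence below the registered `(5/3)·Y₁`). [cite: Saffman1992, §13.1 eq. (4)] -/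
theorem palasekTowerBreakdown_burgersCorner_ceiling (R : TowerRates) (hB : R.N 0 ^ (R.β / 2 - R.b) ≤ 177 / 10)
    (x : EuclideanSpace ℝ (Fin 3)) :
    ‖burgersVortexSwirl (1 * R.A 0) 1 (3 / 2 * R.N (0 + 1) ^ (R.β - 2)) x‖ ≤ 3 / 2 * R.Y (0 + 1) := by
  refine palasekTowerBreakdown_burgers_noOvershoot R 0 (by norm_num) one_pos ?_ x
  rw [Real.sqrt_one, mul_one]
  have h := four_sqrt_two_pi_gt
  nlinarith

/-- **STRAIN FLOOR at natural endowment**: for any rates with `N₀^{β−2b} ≥ 17` (i.e. `B² ≥ 17`), the full Burgers field of the same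
child core has `‖Du‖ ≥ A₁` on its axis (`(3/2)·17 = 25.5 ≥ 8π`). [cite: Saffman1992, §13.1 eq. (3)] -/
theorem palasekTowerBreakdown_burgersCorner_strain (R : TowerRates) (hB2 : (17 : ℝ) ≤ R.N 0 ^ (R.β - 2 * R.b)) :
    ∃ x : EuclideanSpace ℝ (Fin 3),
      1 * R.A (0 + 1) ≤ ‖fderiv ℝ (burgersVortex (1 * R.A 0) 1 (3 / 2 * R.N (0 + 1) ^ (R.β - 2))) x‖ := by
  refine palasekTowerBreakdown_burgers_strainFloor_axis R 0 (by norm_num) one_pos ?_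
  have h8 := palasekTowerBreakdown_eight_pi_lt
  nlinarith

/-! ## §3 The corner: `(N₀, b, β) = (2^23, 41/40, 12/5)` -/

section Corner

variable (R : TowerRates) (hN : R.N₀ = 2 ^ 23) (hb : R.b = 41 / 40) (hβ : R.β = 12 / 5)
include hN hb hβ

/-- At `(2^23, 41/40, 12/5)`: `B = N₀^{β/2−b} = 2^{161/40}` (`23 · 7/40`). [folklore] -/
theorem palasekTowerBreakdown_burgersCorner_factor_eq : R.N 0 ^ (R.β / 2 - R.b) = (2 : ℝ) ^ ((161 : ℝ) / 40) := by
  rw [R.N_zero_eq_N₀, hN, hb, hβ, show ((2 : ℝ) ^ 23 : ℝ) = (2 : ℝ) ^ (23 : ℝ) by norm_num,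
    ← Real.rpow_mul (by norm_num)]
  norm_num

/-- … `∈ (16.27, 16.29)`. [folklore] -/
theorem palasekTowerBreakdown_burgersCorner_factor_bounds :
    16.27 < R.N 0 ^ (R.β / 2 - R.b) ∧ R.N 0 ^ (R.β / 2 - R.b) < 16.29 := by
  rw [palasekTowerBreakdown_burgersCorner_factor_eq R hN hb hβ]
  exact ⟨TowerRates.lt_two_rpow_of_pow_lt (a := 161) (m := 1) (r := 40) (by norm_num) (by norm_num),
    TowerRates.two_rpow_lt_of_pow_lt (by norm_num) (a := 161) (m := 1) (r := 40) (by norm_num) (by norm_num)⟩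

/-- At `(2^23, 41/40, 12/5)`: `N₀^{β−2b} = 2^{161/20} > 264`. [folklore] -/
theorem palasekTowerBreakdown_burgersCorner_factor_sq_gt : (264 : ℝ) < R.N 0 ^ (R.β - 2 * R.b) := by
  have h : R.N 0 ^ (R.β - 2 * R.b) = (2 : ℝ) ^ ((161 : ℝ) / 20) := by
    rw [R.N_zero_eq_N₀, hN, hb, hβ, show ((2 : ℝ) ^ 23 : ℝ) = (2 : ℝ) ^ (23 : ℝ) by norm_num,
      ← Real.rpow_mul (by norm_num)]
    norm_num
  rw [h]
  exact TowerRates.lt_two_rpow_of_pow_lt (a := 161) (m := 1) (r := 20) (by norm_num) (by norm_num)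

/-- **THE CORNER PASSES ALL THREE at `(C, λ) = (3/2, 1)`**: speed floor `Y₁` somewhere, soft ceiling `(3/2)·Y₁` everywhere,
strain floor `A₁` on the axis — for every rates record with `(N₀, b, β) = (2^23, 41/40, 12/5)`. [cite: Saffman1992, §13.1 eq. (4)] -/
theorem palasekTowerBreakdown_burgersCorner_passes :
    (∃ x : EuclideanSpace ℝ (Fin 3),
      1 * R.Y (0 + 1) ≤ ‖burgersVortexSwirl (1 * R.A 0) 1 (3 / 2 * R.N (0 + 1) ^ (R.β - 2)) x‖) ∧
    (∀ x : EuclideanSpace ℝ (Fin 3),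
      ‖burgersVortexSwirl (1 * R.A 0) 1 (3 / 2 * R.N (0 + 1) ^ (R.β - 2)) x‖ ≤ 3 / 2 * R.Y (0 + 1)) ∧
    (∃ x : EuclideanSpace ℝ (Fin 3),
      1 * R.A (0 + 1) ≤ ‖fderiv ℝ (burgersVortex (1 * R.A 0) 1 (3 / 2 * R.N (0 + 1) ^ (R.β - 2))) x‖) := by
  obtain ⟨hlo, hhi⟩ := palasekTowerBreakdown_burgersCorner_factor_bounds R hN hb hβ
  have hsq := palasekTowerBreakdown_burgersCorner_factor_sq_gt R hN hb hβ
  exact ⟨palasekTowerBreakdown_burgersCorner_floor R (by linarith),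
    palasekTowerBreakdown_burgersCorner_ceiling R (by linarith),
    palasekTowerBreakdown_burgersCorner_strain R (by linarith)⟩

end Corner

/-! ## §4 The item of record: on the wide rates every modestly endowed Burgers child misses the speed floor everywhere -/

/-- On the wide rates `B = N₀^{β/2−b} = 256^{1/20} = 2^{2/5}`. [folklore] -/
theorem palasekTowerBreakdown_burgersWide_factor_eq :
    TowerRates.wide.N 0 ^ (TowerRates.wide.β / 2 - TowerRates.wide.b) = (2 : ℝ) ^ ((2 : ℝ) / 5) := by
  rw [TowerRates.wide_N_zero, palasekTowerBreakdown_burgers_exponent_wide,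
    show (256 : ℝ) = (2 : ℝ) ^ (8 : ℝ) by norm_num, ← Real.rpow_mul (by norm_num)]
  norm_num

/-- … `< 1.32`. [folklore] -/
theorem palasekTowerBreakdown_burgersWide_factor_lt :
    TowerRates.wide.N 0 ^ (TowerRates.wide.β / 2 - TowerRates.wide.b) < 1.32 := by
  rw [palasekTowerBreakdown_burgersWide_factor_eq]
  exact TowerRates.two_rpow_lt_of_pow_lt (by norm_num) (a := 2) (m := 1) (r := 5) (by norm_num) (by norm_num)

/-- **THE OSC-1 KILL IN ONE LINE**: on the registered (wide) rates, EVERY Burgers child core of circulation `C·N₁^{β−2}` in a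
strain `λ·A₀` with `C√λ ≤ 13` — thirteen times the circulation floor at the full level-`0` strain, or any trade-off — has swirl
speed `< Y₁` at EVERY point: the level-`1` speed floor is missed on the whole profile (`13 · 1.32 = 17.16 < 4√2π = 17.77`).
[cite: Saffman1992, §13.1 eq. (4)] -/
theorem palasekTowerBreakdown_burgersWide_missesFloor {C l : ℝ} (hC : 0 ≤ C) (hl : 0 < l)
    (hP : C * Real.sqrt l ≤ 13) (x : EuclideanSpace ℝ (Fin 3)) :
    ‖burgersVortexSwirl (l * TowerRates.wide.A 0) 1 (C * TowerRates.wide.N (0 + 1) ^ (TowerRates.wide.β - 2)) x‖ <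
      1 * TowerRates.wide.Y (0 + 1) := by
  refine palasekTowerBreakdown_burgers_lt_floor TowerRates.wide 0 hC hl ?_ x
  have hB := palasekTowerBreakdown_burgersWide_factor_lt
  have hB0 : 0 < TowerRates.wide.N 0 ^ (TowerRates.wide.β / 2 - TowerRates.wide.b) :=
    Real.rpow_pos_of_pos (TowerRates.wide.N_pos 0) _
  have hCl : 0 ≤ C * Real.sqrt l := mul_nonneg hC (Real.sqrt_nonneg l)
  have h4 := four_sqrt_two_pi_gt
  calc C * Real.sqrt l * TowerRates.wide.N 0 ^ (TowerRates.wide.β / 2 - TowerRates.wide.b)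
      ≤ 13 * 1.32 := mul_le_mul hP hB.le hB0.le (by norm_num)
    _ < 4 * Real.sqrt 2 * π * 1 := by nlinarith

/-- **The contrast in one statement**: the SAME natural endowment `(C, λ) = (3/2, 1)` misses the speed floor everywhere on the
registered rates and meets floor, soft ceiling and strain floor at `(2^23, 41/40, 12/5)`. [cite: Saffman1992, §13.1 eq. (4)] -/
theorem palasekTowerBreakdown_burgersCorner_contrast (R : TowerRates) (hN : R.N₀ = 2 ^ 23) (hb : R.b = 41 / 40)
    (hβ : R.β = 12 / 5) :
    (∀ x : EuclideanSpace ℝ (Fin 3),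
      ‖burgersVortexSwirl (1 * TowerRates.wide.A 0) 1 (3 / 2 * TowerRates.wide.N (0 + 1) ^ (TowerRates.wide.β - 2)) x‖ <
        1 * TowerRates.wide.Y (0 + 1)) ∧
    (∃ x : EuclideanSpace ℝ (Fin 3),
      1 * R.Y (0 + 1) ≤ ‖burgersVortexSwirl (1 * R.A 0) 1 (3 / 2 * R.N (0 + 1) ^ (R.β - 2)) x‖) :=
  ⟨fun x => palasekTowerBreakdown_burgersWide_missesFloor (by norm_num) one_pos
      (by rw [Real.sqrt_one]; norm_num) x,
    (palasekTowerBreakdown_burgersCorner_passes R hN hb hβ).1⟩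

end Summit.NavierStokesRegularity.FluidComputer.PalasekTowerClayBridge

end
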